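import Summits.Ventures.PercRepro.C041GlueFold

/-!
# ROW C-041 — THE FOLD'S VERTICES, EDGES AND MARKS: injections of the summands, the field equivalences and the
end maps of an iterated gluing at the anchor (p6, gen 30)

The fold `foldGlue d f acc` of `C041GlueFold` glues the `d` packages `f j` at the anchor onto `acc`.  Its vertices
receive the accumulator's (`foldAccV`, the anchor to the anchor: `foldGlue_k`) and each summand's (`foldInjV j`, the
summand's anchor to the fold's anchor: `foldInjV_k`); its edges, `1`-marks and `2`-marks are EXACTLY the summands'
and the accumulator's (`foldEquiv`, one equivalence for every field that is a sum on `glue`: `foldEquivE`,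
`foldEquivT₁`, `foldEquivT₂`; computation rules `foldEquiv_inl_castSucc`, `foldEquiv_inl_last`, `foldEquiv_inr`),
and the end maps commute with the injections (`fst_foldEquivE_inl`, `fst_foldEquivE_inr`, …, `at₂_foldEquivT₂_inr`).
These are the tools of `C041TreeEmb`, where the canonical zone of a rooted marked tree embeds into its model.
-/

namespace PercRepro

namespace ZoneZ

namespace AZone

open ZoneData TreeClosure Pendant AnchorGlue PointZone

/-! ## The vertices of the fold -/

/-- The accumulator's vertices inside the fold. -/
def foldAccV : (d : ℕ) → (f : Fin d → AZone) → (acc : AZone) → acc.V → (foldGlue d f acc).V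
  | 0, _, _, a => a
  | d + 1, f, acc, a => Sum.inl (foldAccV d (fun j => f j.castSucc) acc a)

/-- The fold's anchor is the accumulator's. -/
theorem foldGlue_k : ∀ (d : ℕ) (f : Fin d → AZone) (acc : AZone), (foldGlue d f acc).k = foldAccV d f acc acc.k
  | 0, _, _ => rfl
  | d + 1, f, acc => by
    show Sum.inl (foldGlue d (fun j => f j.castSucc) acc).k = Sum.inl (foldAccV d (fun j => f j.castSucc) acc acc.k)
    rw [foldGlue_k d]

/-- The `j`-th summand's vertices inside the fold (its anchor goes to the fold's anchor). -/
noncomputable def foldInjV : (d : ℕ) → (f : Fin d → AZone) → (acc : AZone) → (j : Fin d) → (f j).V →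
    (foldGlue d f acc).V
  | 0, _, _, j, _ => j.elim0
  | d + 1, f, acc, j, x =>
    Fin.lastCases (motive := fun j => (f j).V → (foldGlue (d + 1) f acc).V)
      (fun y => red (foldGlue d (fun j => f j.castSucc) acc).k (f (Fin.last d)).k y)
      (fun j y => Sum.inl (foldInjV d (fun j => f j.castSucc) acc j y)) j x

/-- The last summand. -/
theorem foldInjV_last (d : ℕ) (f : Fin (d + 1) → AZone) (acc : AZone) (y : (f (Fin.last d)).V) :
    foldInjV (d + 1) f acc (Fin.last d) y =
      red (foldGlue d (fun j => f j.castSucc) acc).k (f (Fin.last d)).k y := by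
  simp [foldInjV]

/-- An earlier summand. -/
theorem foldInjV_castSucc (d : ℕ) (f : Fin (d + 1) → AZone) (acc : AZone) (j : Fin d) (y : (f j.castSucc).V) :
    foldInjV (d + 1) f acc j.castSucc y = Sum.inl (foldInjV d (fun j => f j.castSucc) acc j y) := by
  simp [foldInjV]

/-- A summand's anchor goes to the fold's anchor. -/
theorem foldInjV_k : ∀ (d : ℕ) (f : Fin d → AZone) (acc : AZone) (j : Fin d),
    foldInjV d f acc j (f j).k = foldAccV d f acc acc.k
  | 0, _, _, j => j.elim0
  | d + 1, f, acc, j => by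
    induction j using Fin.lastCases with
    | last =>
      rw [foldInjV_last, red_self]
      show Sum.inl (foldGlue d (fun j => f j.castSucc) acc).k = _
      rw [foldGlue_k d]
      rfl
    | cast j =>
      rw [foldInjV_castSucc]
      show Sum.inl _ = Sum.inl _
      rw [foldInjV_k d]

/-! ## The edges and marks of the fold -/

/-- A field of packages that is a sum on `glue` (edges, `1`-marks, `2`-marks): the fold's field is the sum of the
summands' and the accumulator's. -/
noncomputable def foldEquiv (F : AZone → Type) (sF : ∀ A B, F (glue A B) ≃ F A ⊕ F B) :
    (d : ℕ) → (f : Fin d → AZone) → (acc : AZone) → ((Σ j, F (f j)) ⊕ F acc) ≃ F (foldGlue d f acc)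
  | 0, f, acc => Equiv.emptySum (Σ j : Fin 0, F (f j)) (F acc)
  | d + 1, f, acc =>
    ((sigmaFinLast (fun j => F (f j))).sumCongr (Equiv.refl (F acc))).trans
      ((Equiv.sumAssoc _ _ _).trans
        (((Equiv.refl _).sumCongr (Equiv.sumComm _ _)).trans
          ((Equiv.sumAssoc _ _ _).symm.trans
            (((foldEquiv F sF d (fun j => f j.castSucc) acc).sumCongr (Equiv.refl (F (f (Fin.last d))))).trans
              (sF _ _).symm))))

/-- The fold equivalence on an earlier summand. -/
theorem foldEquiv_inl_castSucc (F : AZone → Type) (sF : ∀ A B, F (glue A B) ≃ F A ⊕ F B) (d : ℕ)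
    (f : Fin (d + 1) → AZone) (acc : AZone) (j : Fin d) (x : F (f j.castSucc)) :
    foldEquiv F sF (d + 1) f acc (Sum.inl ⟨j.castSucc, x⟩) =
      (sF _ _).symm (Sum.inl (foldEquiv F sF d (fun j => f j.castSucc) acc (Sum.inl ⟨j, x⟩))) := by
  simp only [foldEquiv, Equiv.trans_apply, Equiv.sumCongr_apply, Sum.map_inl, sigmaFinLast_castSucc,
    Equiv.sumAssoc_apply_inl_inl, Equiv.sumAssoc_symm_apply_inl, Equiv.refl_apply]
  rfl

/-- The fold equivalence on the last summand. -/
theorem foldEquiv_inl_last (F : AZone → Type) (sF : ∀ A B, F (glue A B) ≃ F A ⊕ F B) (d : ℕ)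
    (f : Fin (d + 1) → AZone) (acc : AZone) (x : F (f (Fin.last d))) :
    foldEquiv F sF (d + 1) f acc (Sum.inl ⟨Fin.last d, x⟩) = (sF _ _).symm (Sum.inr x) := by
  simp only [foldEquiv, Equiv.trans_apply, Equiv.sumCongr_apply, Sum.map_inl, Sum.map_inr, sigmaFinLast_last,
    Equiv.sumAssoc_apply_inl_inr, Equiv.sumComm_apply, Sum.swap_inl, Equiv.sumAssoc_symm_apply_inr_inr,
    Equiv.refl_apply]
  rfl

/-- The fold equivalence on the accumulator. -/
theorem foldEquiv_inr (F : AZone → Type) (sF : ∀ A B, F (glue A B) ≃ F A ⊕ F B) (d : ℕ)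
    (f : Fin (d + 1) → AZone) (acc : AZone) (a : F acc) :
    foldEquiv F sF (d + 1) f acc (Sum.inr a) =
      (sF _ _).symm (Sum.inl (foldEquiv F sF d (fun j => f j.castSucc) acc (Sum.inr a))) := by
  simp only [foldEquiv, Equiv.trans_apply, Equiv.sumCongr_apply, Sum.map_inl, Sum.map_inr,
    Equiv.sumAssoc_apply_inr, Equiv.sumComm_apply, Sum.swap_inr, Equiv.sumAssoc_symm_apply_inr_inl,
    Equiv.refl_apply]
  rfl

/-- The edges of the fold. -/
noncomputable abbrev foldEquivE (d : ℕ) (f : Fin d → AZone) (acc : AZone) :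
    ((Σ j, (f j).E) ⊕ acc.E) ≃ (foldGlue d f acc).E :=
  foldEquiv AZone.E (fun _ _ => Equiv.refl _) d f acc

/-- The `1`-marks of the fold. -/
noncomputable abbrev foldEquivT₁ (d : ℕ) (f : Fin d → AZone) (acc : AZone) :
    ((Σ j, (f j).T₁) ⊕ acc.T₁) ≃ (foldGlue d f acc).T₁ :=
  foldEquiv AZone.T₁ (fun _ _ => Equiv.refl _) d f acc

/-- The `2`-marks of the fold. -/
noncomputable abbrev foldEquivT₂ (d : ℕ) (f : Fin d → AZone) (acc : AZone) :
    ((Σ j, (f j).T₂) ⊕ acc.T₂) ≃ (foldGlue d f acc).T₂ :=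
  foldEquiv AZone.T₂ (fun _ _ => Equiv.refl _) d f acc

/-! ## The end maps of the fold -/

/-- The first end of a summand's edge. -/
theorem fst_foldEquivE_inl : ∀ (d : ℕ) (f : Fin d → AZone) (acc : AZone) (j : Fin d) (e : (f j).E),
    (foldGlue d f acc).Z.fst (foldEquivE d f acc (Sum.inl ⟨j, e⟩)) = foldInjV d f acc j ((f j).Z.fst e)
  | 0, _, _, j, _ => j.elim0
  | d + 1, f, acc, j, e => by
    induction j using Fin.lastCases with
    | last =>
      rw [foldEquiv_inl_last, foldInjV_last]
      rfl
    | cast j =>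
      rw [foldEquiv_inl_castSucc, foldInjV_castSucc]
      show Sum.inl ((foldGlue d (fun j => f j.castSucc) acc).Z.fst _) = _
      rw [fst_foldEquivE_inl d]

/-- The second end of a summand's edge. -/
theorem snd_foldEquivE_inl : ∀ (d : ℕ) (f : Fin d → AZone) (acc : AZone) (j : Fin d) (e : (f j).E),
    (foldGlue d f acc).Z.snd (foldEquivE d f acc (Sum.inl ⟨j, e⟩)) = foldInjV d f acc j ((f j).Z.snd e)
  | 0, _, _, j, _ => j.elim0
  | d + 1, f, acc, j, e => by
    induction j using Fin.lastCases with
    | last =>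
      rw [foldEquiv_inl_last, foldInjV_last]
      rfl
    | cast j =>
      rw [foldEquiv_inl_castSucc, foldInjV_castSucc]
      show Sum.inl ((foldGlue d (fun j => f j.castSucc) acc).Z.snd _) = _
      rw [snd_foldEquivE_inl d]

/-- The first end of an accumulator edge. -/
theorem fst_foldEquivE_inr : ∀ (d : ℕ) (f : Fin d → AZone) (acc : AZone) (e : acc.E),
    (foldGlue d f acc).Z.fst (foldEquivE d f acc (Sum.inr e)) = foldAccV d f acc (acc.Z.fst e)
  | 0, _, _, _ => rfl
  | d + 1, f, acc, e => by
    rw [foldEquiv_inr]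
    show Sum.inl ((foldGlue d (fun j => f j.castSucc) acc).Z.fst _) = _
    rw [fst_foldEquivE_inr d]
    rfl

/-- The second end of an accumulator edge. -/
theorem snd_foldEquivE_inr : ∀ (d : ℕ) (f : Fin d → AZone) (acc : AZone) (e : acc.E),
    (foldGlue d f acc).Z.snd (foldEquivE d f acc (Sum.inr e)) = foldAccV d f acc (acc.Z.snd e)
  | 0, _, _, _ => rfl
  | d + 1, f, acc, e => by
    rw [foldEquiv_inr]
    show Sum.inl ((foldGlue d (fun j => f j.castSucc) acc).Z.snd _) = _
    rw [snd_foldEquivE_inr d]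
    rfl

/-- The vertex of a summand's `1`-mark. -/
theorem at₁_foldEquivT₁_inl : ∀ (d : ℕ) (f : Fin d → AZone) (acc : AZone) (j : Fin d) (m : (f j).T₁),
    (foldGlue d f acc).Z.at₁ (foldEquivT₁ d f acc (Sum.inl ⟨j, m⟩)) = foldInjV d f acc j ((f j).Z.at₁ m)
  | 0, _, _, j, _ => j.elim0
  | d + 1, f, acc, j, m => by
    induction j using Fin.lastCases with
    | last =>
      rw [foldEquiv_inl_last, foldInjV_last]
      rfl
    | cast j =>
      rw [foldEquiv_inl_castSucc, foldInjV_castSucc]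
      show Sum.inl ((foldGlue d (fun j => f j.castSucc) acc).Z.at₁ _) = _
      rw [at₁_foldEquivT₁_inl d]

/-- The vertex of an accumulator `1`-mark. -/
theorem at₁_foldEquivT₁_inr : ∀ (d : ℕ) (f : Fin d → AZone) (acc : AZone) (m : acc.T₁),
    (foldGlue d f acc).Z.at₁ (foldEquivT₁ d f acc (Sum.inr m)) = foldAccV d f acc (acc.Z.at₁ m)
  | 0, _, _, _ => rfl
  | d + 1, f, acc, m => by
    rw [foldEquiv_inr]
    show Sum.inl ((foldGlue d (fun j => f j.castSucc) acc).Z.at₁ _) = _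
    rw [at₁_foldEquivT₁_inr d]
    rfl

/-- The vertex of a summand's `2`-mark. -/
theorem at₂_foldEquivT₂_inl : ∀ (d : ℕ) (f : Fin d → AZone) (acc : AZone) (j : Fin d) (m : (f j).T₂),
    (foldGlue d f acc).Z.at₂ (foldEquivT₂ d f acc (Sum.inl ⟨j, m⟩)) = foldInjV d f acc j ((f j).Z.at₂ m)
  | 0, _, _, j, _ => j.elim0
  | d + 1, f, acc, j, m => by
    induction j using Fin.lastCases with
    | last =>
      rw [foldEquiv_inl_last, foldInjV_last]
      rfl
    | cast j =>
      rw [foldEquiv_inl_castSucc, foldInjV_castSucc]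
      show Sum.inl ((foldGlue d (fun j => f j.castSucc) acc).Z.at₂ _) = _
      rw [at₂_foldEquivT₂_inl d]

/-- The vertex of an accumulator `2`-mark. -/
theorem at₂_foldEquivT₂_inr : ∀ (d : ℕ) (f : Fin d → AZone) (acc : AZone) (m : acc.T₂),
    (foldGlue d f acc).Z.at₂ (foldEquivT₂ d f acc (Sum.inr m)) = foldAccV d f acc (acc.Z.at₂ m)
  | 0, _, _, _ => rfl
  | d + 1, f, acc, m => by
    rw [foldEquiv_inr]
    show Sum.inl ((foldGlue d (fun j => f j.castSucc) acc).Z.at₂ _) = _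
    rw [at₂_foldEquivT₂_inr d]
    rfl

end AZone

end ZoneZ

end PercRepro
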